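import Summits.Ventures.Crystal3D.Theorems.StickyWulffConstantTextureBuildFccCell
import HarnessLib

/-!
# TB-D: MASS BRICK (M4, all sites) — the twelve-neighbour cell of EVERY site of every close-packed stacking has volume `1/√2`
# (lane T, crux `TextureLiminfV5`, stmt-Ventures-23912; design memo TB-D-0 §3 (M4) both shells, §5; helper seat wulff-tb-w1; part 4 of the MASS bricks)

HONEST FRAMING. Venture `Summits/Ventures/Crystal3D` (cell `crystal3d-full`), route `route-Ventures-StickyWulffConstant`, helper
`--supports` the law-v5 crux `TextureLiminfV5` (stmt-Ventures-23912).  Coordinates of the moved Barlow stackings `stacking L s σ` and measure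
theory (census-free, standard axioms); nothing about any texture, cover or mesh; F-C1 not moved.

THE HALF-CELL ARGUMENT (TB-D-0 §3 (M4): «the two dodecahedra are equidecomposable by the basal mirror on one half»).  In the frame of the
stacking, the cell of the site `r = barlowPos σ k i j`, translated to the origin, is cut out by twelve half-spaces `⟪p, d⟫ < 1/2`: six in-plane
rows (`sixOffsets`, letter shift `0`), three from layer `k+1` (offsets `threeOffsets (−σ k)`, letter shift `σ k`, height `+h`) and three from
layer `k−1` (offsets `threeOffsets (σ (k−1))`, letter shift `−σ (k−1)`, height `−h`) — `rowSet`, `mem_cell₁₂_barlowPos_iff`.  ABOVE the basal plane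
`p₂ > 0` the three lower rows are implied by the six in-plane rows (`rowOK_three_of_six`: the in-plane part of a lower row is the average of two
hexagon rows and `0`, so it is `< 1/3`), so the upper half-cell depends only on `σ k`, the lower half only on `σ (k−1)`; the basal mirror
`basalMirror` exchanges lower halves with upper halves, and the in-plane half-turn `p ↦ −basalMirror p` exchanges the two letter shifts.  Hence all
four local types (`σ k, σ (k−1) = ±1, ±1`: the cuboctahedral/fcc shells `(1,1), (−1,−1)` and the anticuboctahedral/hcp shells `(1,−1), (−1,1)`) have
cells of the same volume, namely that of the fcc reference cell, `√2/2` (`…TextureBuildFccCell.volume_cell₁₂_fccRef_zero`).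

* `rowSet`, `inner_sub_barlowPos_offset`, `mem_cell₁₂_barlowPos_iff` (half-space form of the cell), `rowOK_three_of_six` (inactive rows),
  `rowOK_basalMirror`, `rowOK_six_halfTurn`, `rowOK_three_halfTurn` (symmetries), `volume_halfCell_eq` ;
* **`volume_cell₁₂_barlowPos`**, **`volume_cell₁₂_of_mem_stacking`** — for every Hägg word `σ`, frame `(L, s)` and site `a ∈ stacking L s σ`:
  `volume {z | ∀ v ∈ stacking L s σ, dist a v = 1 → dist z a < dist z v} = ENNReal.ofReal (√2/2)`;
* **`volume_biUnion_cell₁₂`**, `biUnion_cell₁₂_subset`, **`card_mul_le_volume_of_closedBalls_subset`** — the MASS GLUE (TB-D-0 §3 (M5)): finitely many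
  locally perfect balls of a `1`-separated `X` carry pairwise disjoint cells of total volume `#·√2/2` inside `⋃ closedBall a √2`, so any set
  containing these balls has `# ≤ √2·volume`.
-/

noncomputable section

open scoped BigOperators InnerProductSpace ENNReal

namespace Summit.Ventures.Crystal3D.Cruxes.TextureLiminf.TexShadow

open Summit.Ventures.Crystal3D Metric MeasureTheory
open Summit.Ventures.Crystal3D.TentCertificate (hB hB_sq hB_pos)
open Literature.MathematicalPhysics.StatisticalMechanics (barlowPos barlowStacking barlowPos_mem IsHaggSeq haggLabel haggLabel_succ constHagg
  haggLabel_const isHaggSeq_const sixOffsets threeOffsets offsetPos touching_eq_union haggLabel_sub_haggLabel_succ haggLabel_sub_haggLabel_pred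
  mem_barlowStacking_iff barlowPos_apply_zero barlowPos_apply_one barlowPos_apply_two basalMirror basalMirror_apply_coord)

/-! ### The half-space rows of the cell in the frame of the stacking -/

/-- A ROW of cell constraints in stacking coordinates: for every offset `(P, Q) ∈ O`, with letter shift `Λ` and height coefficient `ε`,
`p₀·(−P − Q/2 + Λ/2) + p₁·(√3/2)(−Q + Λ/3) + p₂·ε < 1/2` — the half-space `⟪p, d⟫ < 1/2` of the neighbour at offset `(P, Q)`. -/
def rowSet (O : Finset (ℤ × ℤ)) (Λ ε : ℝ) : Set E3 :=
  {p : E3 | ∀ PQ ∈ O, p 0 * (-(PQ.1 : ℝ) - (PQ.2 : ℝ) / 2 + Λ / 2) + p 1 * (Real.sqrt 3 / 2 * (-(PQ.2 : ℝ) + Λ / 3)) + p 2 * ε < 1 / 2}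

/-- Membership in a row set, unfolded. -/
theorem mem_rowSet_iff (O : Finset (ℤ × ℤ)) (Λ ε : ℝ) (p : E3) :
    p ∈ rowSet O Λ ε ↔ ∀ PQ ∈ O, p 0 * (-(PQ.1 : ℝ) - (PQ.2 : ℝ) / 2 + Λ / 2) + p 1 * (Real.sqrt 3 / 2 * (-(PQ.2 : ℝ) + Λ / 3)) + p 2 * ε < 1 / 2 :=
  Iff.rfl

/-- The inner product of `z − r` with a neighbour offset `offsetPos i j k' (P,Q) − r`, `r = barlowPos σ k i j`, in coordinates. -/
theorem inner_sub_barlowPos_offset (σ : ℤ → ℤ) (z : E3) (k i j k' : ℤ) (PQ : ℤ × ℤ) :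
    ⟪z - barlowPos 1 hB σ k i j, offsetPos 1 hB σ i j k' PQ - barlowPos 1 hB σ k i j⟫_ℝ =
      (z - barlowPos 1 hB σ k i j) 0 * (-(PQ.1 : ℝ) - (PQ.2 : ℝ) / 2 + ((haggLabel σ k' : ℝ) - haggLabel σ k) / 2) +
      (z - barlowPos 1 hB σ k i j) 1 * (Real.sqrt 3 / 2 * (-(PQ.2 : ℝ) + ((haggLabel σ k' : ℝ) - haggLabel σ k) / 3)) +
      (z - barlowPos 1 hB σ k i j) 2 * (((k' : ℝ) - k) * hB) := by
  rw [EuclideanSpace.inner_eq_star_dotProduct]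
  simp only [offsetPos, dotProduct, Fin.sum_univ_three, star_trivial, WithLp.ofLp_sub, Pi.sub_apply]
  simp only [barlowPos_apply_zero, barlowPos_apply_one, barlowPos_apply_two]
  push_cast
  ring

/-- **Half-space form of the twelve-neighbour cell.**  `z` is in the cell of `r = barlowPos σ k i j` iff `p = z − r` satisfies the six in-plane rows,
the three rows of layer `k+1` (letter shift `σ k`, height `+h`) and the three rows of layer `k−1` (letter shift `−σ(k−1)`, height `−h`). -/
theorem mem_cell₁₂_barlowPos_iff {σ : ℤ → ℤ} (hσ : IsHaggSeq σ) (k i j : ℤ) (z : E3) :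
    z ∈ {z : E3 | ∀ v ∈ barlowStacking 1 hB σ, dist (barlowPos 1 hB σ k i j) v = 1 → dist z (barlowPos 1 hB σ k i j) < dist z v} ↔
      z - barlowPos 1 hB σ k i j ∈ rowSet sixOffsets 0 0 ∧ z - barlowPos 1 hB σ k i j ∈ rowSet (threeOffsets (-σ k)) (σ k) hB ∧
        z - barlowPos 1 hB σ k i j ∈ rowSet (threeOffsets (σ (k - 1))) (-(σ (k - 1) : ℝ)) (-hB) := by
  have hT := touching_eq_union hσ one_pos hB_sq' k i j
  -- membership in the cell as a statement over the touching set
  have step : z ∈ {z : E3 | ∀ v ∈ barlowStacking 1 hB σ, dist (barlowPos 1 hB σ k i j) v = 1 →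
        dist z (barlowPos 1 hB σ k i j) < dist z v} ↔
      ∀ v ∈ {w | w ∈ barlowStacking 1 hB σ ∧ dist (barlowPos 1 hB σ k i j) w = 1},
        ⟪z - barlowPos 1 hB σ k i j, v - barlowPos 1 hB σ k i j⟫_ℝ < 1 / 2 := by
    simp only [Set.mem_setOf_eq, and_imp]
    constructor
    · intro h v hv hd; exact (dist_lt_dist_iff_inner_lt_half hd).1 (h v hv hd)
    · intro h v hv hd; exact (dist_lt_dist_iff_inner_lt_half hd).2 (h v hv hd)
  have e0 : ((haggLabel σ k : ℝ) - haggLabel σ k) = 0 := sub_self _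
  have e1 : ((haggLabel σ (k + 1) : ℝ) - haggLabel σ k) = σ k := by rw [haggLabel_succ]; push_cast; ring
  have e2 : ((haggLabel σ (k - 1) : ℝ) - haggLabel σ k) = -σ (k - 1) := by
    have := haggLabel_sub_haggLabel_pred σ k
    have h' : (haggLabel σ k : ℝ) - haggLabel σ (k - 1) = σ (k - 1) := by exact_mod_cast this
    linarith
  have f0 : ((k : ℝ) - k) * hB = 0 := by ring
  have f1 : (((k + 1 : ℤ) : ℝ) - k) * hB = hB := by push_cast; ring
  have f2 : (((k - 1 : ℤ) : ℝ) - k) * hB = -hB := by push_cast; ring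
  have key : ∀ (k' : ℤ) (PQ : ℤ × ℤ), ⟪z - barlowPos 1 hB σ k i j, offsetPos 1 hB σ i j k' PQ - barlowPos 1 hB σ k i j⟫_ℝ < 1 / 2 ↔
      (z - barlowPos 1 hB σ k i j) 0 * (-(PQ.1 : ℝ) - (PQ.2 : ℝ) / 2 + ((haggLabel σ k' : ℝ) - haggLabel σ k) / 2) +
      (z - barlowPos 1 hB σ k i j) 1 * (Real.sqrt 3 / 2 * (-(PQ.2 : ℝ) + ((haggLabel σ k' : ℝ) - haggLabel σ k) / 3)) +
      (z - barlowPos 1 hB σ k i j) 2 * (((k' : ℝ) - k) * hB) < 1 / 2 := fun k' PQ => by rw [inner_sub_barlowPos_offset]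
  rw [step, hT]
  simp only [Set.mem_union, or_imp, forall_and, Set.forall_mem_image, Finset.mem_coe, key, mem_rowSet_iff, e0, e1, e2, f0, f1, f2]

/-! ### Inactive rows: above the basal plane the lower rows follow from the hexagon rows -/

/-- **Inactive rows.**  If `p₂·ε ≤ 0` and `p` satisfies the six in-plane rows, then it satisfies the three rows with letter shift `τ = ±1` and height
coefficient `ε`: the in-plane part of such a row is `⅓·(row + row')` for two hexagon rows, hence `< 1/3`. -/
theorem rowOK_three_of_six {τ : ℤ} (hτ : τ = 1 ∨ τ = -1) {ε : ℝ} {p : E3} (hε : p 2 * ε ≤ 0) (h6 : p ∈ rowSet sixOffsets 0 0) :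
    p ∈ rowSet (threeOffsets (-τ)) τ ε := by
  rw [mem_rowSet_iff] at h6 ⊢
  have h1 := h6 (1, 0) (by decide)
  have h2 := h6 (-1, 0) (by decide)
  have h3 := h6 (0, 1) (by decide)
  have h4 := h6 (0, -1) (by decide)
  have h5 := h6 (1, -1) (by decide)
  have h7 := h6 (-1, 1) (by decide)
  simp only [Int.cast_one, Int.cast_zero, Int.cast_neg] at h1 h2 h3 h4 h5 h7
  intro PQ hPQ
  rcases hτ with rfl | rfl
  · simp only [threeOffsets, show (-(1:ℤ)) ≠ 1 by decide, if_false, Finset.mem_insert, Finset.mem_singleton] at hPQ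
    rcases hPQ with rfl | rfl | rfl <;> simp only [Int.cast_one, Int.cast_zero] <;> nlinarith
  · simp only [threeOffsets, neg_neg, if_true, Finset.mem_insert, Finset.mem_singleton] at hPQ
    rcases hPQ with rfl | rfl | rfl <;> simp only [Int.cast_one, Int.cast_zero, Int.cast_neg] <;> nlinarith

/-! ### Symmetries of the rows -/

/-- The basal mirror flips the height coefficient of a row. -/
theorem rowOK_basalMirror (O : Finset (ℤ × ℤ)) (Λ ε : ℝ) (p : E3) : basalMirror p ∈ rowSet O Λ ε ↔ p ∈ rowSet O Λ (-ε) := by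
  simp only [mem_rowSet_iff, basalMirror_apply_coord]
  simp only [show ((0 : Fin 3) = 2) = False by decide, show ((1 : Fin 3) = 2) = False by decide, if_false, if_true]
  constructor <;> intro h PQ hPQ <;> have := h PQ hPQ <;> linarith

/-- The in-plane half-turn `p ↦ −basalMirror p` preserves the hexagon rows. -/
theorem rowOK_six_halfTurn (p : E3) : -basalMirror p ∈ rowSet sixOffsets 0 0 ↔ p ∈ rowSet sixOffsets 0 0 := by
  have key : ∀ q : E3, q ∈ rowSet sixOffsets 0 0 → -basalMirror q ∈ rowSet sixOffsets 0 0 := by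
    intro q h
    rw [mem_rowSet_iff] at h ⊢
    intro PQ hPQ
    simp only [PiLp.neg_apply, basalMirror_apply_coord, show ((0 : Fin 3) = 2) = False by decide,
      show ((1 : Fin 3) = 2) = False by decide, if_false]
    have hneg : (-PQ.1, -PQ.2) ∈ sixOffsets := by
      simp only [sixOffsets, Finset.mem_insert, Finset.mem_singleton, Prod.mk.injEq] at hPQ ⊢
      rcases hPQ with ⟨h1, h2⟩ | ⟨h1, h2⟩ | ⟨h1, h2⟩ | ⟨h1, h2⟩ | ⟨h1, h2⟩ | ⟨h1, h2⟩ <;> omega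
    have := h (-PQ.1, -PQ.2) hneg
    simp only [Int.cast_neg] at this
    linarith
  constructor
  · intro h
    have := key _ h
    simpa [Literature.MathematicalPhysics.StatisticalMechanics.basalMirror_basalMirror] using this
  · exact key p

/-- The in-plane half-turn exchanges the two letter shifts of an adjacent-layer row. -/
theorem rowOK_three_halfTurn {τ : ℤ} (hτ : τ = 1 ∨ τ = -1) (ε : ℝ) (p : E3) :
    -basalMirror p ∈ rowSet (threeOffsets (-τ)) τ ε ↔ p ∈ rowSet (threeOffsets τ) (-(τ : ℝ)) ε := by
  have key : ∀ (t : ℤ), (t = 1 ∨ t = -1) → ∀ q : E3, q ∈ rowSet (threeOffsets t) (-(t : ℝ)) ε →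
      -basalMirror q ∈ rowSet (threeOffsets (-t)) t ε := by
    intro t ht q h
    rw [mem_rowSet_iff] at h ⊢
    intro PQ hPQ
    simp only [PiLp.neg_apply, basalMirror_apply_coord, show ((0 : Fin 3) = 2) = False by decide,
      show ((1 : Fin 3) = 2) = False by decide, if_false, if_true, neg_neg]
    have hneg : (-PQ.1, -PQ.2) ∈ threeOffsets t := by
      rcases ht with rfl | rfl
      · simp only [threeOffsets, show (-(1:ℤ)) ≠ 1 by decide, if_false, if_true, Finset.mem_insert, Finset.mem_singleton,
          Prod.mk.injEq] at hPQ ⊢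
        rcases hPQ with ⟨h1, h2⟩ | ⟨h1, h2⟩ | ⟨h1, h2⟩ <;> omega
      · simp only [threeOffsets, neg_neg, show (-(1:ℤ)) ≠ 1 by decide, if_false, if_true, Finset.mem_insert, Finset.mem_singleton,
          Prod.mk.injEq] at hPQ ⊢
        rcases hPQ with ⟨h1, h2⟩ | ⟨h1, h2⟩ | ⟨h1, h2⟩ <;> omega
    have := h (-PQ.1, -PQ.2) hneg
    simp only [Int.cast_neg] at this
    linarith
  constructor
  · intro h
    have hτ' : -τ = 1 ∨ -τ = -1 := by rcases hτ with rfl | rfl <;> simp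
    have h' : -basalMirror p ∈ rowSet (threeOffsets (-τ)) (-((-τ : ℤ) : ℝ)) ε := by simpa [Int.cast_neg] using h
    have := key (-τ) hτ' _ h'
    simpa [Literature.MathematicalPhysics.StatisticalMechanics.basalMirror_basalMirror, Int.cast_neg] using this
  · exact key τ hτ p

/-! ### Volumes of the half-cells -/

/-- The third coordinate is measurable. -/
theorem measurable_apply_two : Measurable fun p : E3 => p 2 := (show Continuous (fun p : E3 => p 2) by fun_prop).measurable

/-- The basal plane is null. -/
theorem volume_basalPlane : volume {p : E3 | p 2 = 0} = 0 := by
  have h : {p : E3 | p 2 = 0} = {p : E3 | ⟪EuclideanSpace.single (2 : Fin 3) (1 : ℝ), p⟫_ℝ = 0} := by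
    ext p; simp [EuclideanSpace.inner_single_left]
  rw [h]
  exact Summit.Ventures.Crystal3D.Theorems.volume_setOf_inner_eq_zero (by simp) 0

/-- Splitting a set by the basal plane: `vol S = vol (S ∩ {p₂ > 0}) + vol (S ∩ {p₂ < 0})`. -/
theorem volume_eq_upper_add_lower (S : Set E3) :
    volume S = volume (S ∩ {p : E3 | 0 < p 2}) + volume (S ∩ {p : E3 | p 2 < 0}) := by
  have hH : MeasurableSet {p : E3 | 0 < p 2} := measurableSet_lt measurable_const measurable_apply_two
  have hH' : MeasurableSet {p : E3 | p 2 < 0} := measurableSet_lt measurable_apply_two measurable_const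
  rw [← measure_inter_add_sdiff S hH, ← measure_inter_add_sdiff (S \ {p : E3 | 0 < p 2}) hH']
  have h1 : (S \ {p : E3 | 0 < p 2}) ∩ {p : E3 | p 2 < 0} = S ∩ {p : E3 | p 2 < 0} := by
    ext p; simp only [Set.mem_inter_iff, Set.mem_sdiff, Set.mem_setOf_eq, not_lt]
    constructor
    · rintro ⟨⟨h, -⟩, h'⟩; exact ⟨h, h'⟩
    · rintro ⟨h, h'⟩; exact ⟨⟨h, h'.le⟩, h'⟩
  have h0 : volume ((S \ {p : E3 | 0 < p 2}) \ {p : E3 | p 2 < 0}) = 0 := by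
    refine measure_mono_null (fun p hp => ?_) volume_basalPlane
    simp only [Set.mem_sdiff, Set.mem_setOf_eq, not_lt] at hp
    exact le_antisymm hp.1.2 hp.2
  rw [h1, h0, add_zero]

/-- The UPPER HALF-CELL of letter shift `τ`: `p₂ > 0`, hexagon rows, and the three rows of the layer above. -/
def halfCell (τ : ℤ) : Set E3 := {p : E3 | 0 < p 2} ∩ rowSet sixOffsets 0 0 ∩ rowSet (threeOffsets (-τ)) τ hB

/-- The two half-cells `τ = ±1` have the same volume (the in-plane half-turn is a volume-preserving bijection between them). -/
theorem volume_halfCell_eq {τ : ℤ} (hτ : τ = 1 ∨ τ = -1) : volume (halfCell (-τ)) = volume (halfCell τ) := by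
  set N : E3 ≃ₗᵢ[ℝ] E3 := basalMirror.trans (LinearIsometryEquiv.neg ℝ) with hN
  have hNapply : ∀ p : E3, N p = -basalMirror p := fun p => rfl
  have hpre : N ⁻¹' halfCell τ = halfCell (-τ) := by
    ext p
    simp only [Set.mem_preimage, halfCell, Set.mem_inter_iff, Set.mem_setOf_eq, hNapply, rowOK_six_halfTurn, rowOK_three_halfTurn hτ,
      neg_neg, Int.cast_neg]
    simp only [PiLp.neg_apply, basalMirror_apply_coord, if_true, neg_neg]
  rw [← hpre, ← N.coe_toMeasurableEquiv, (N.measurePreserving).measure_preimage_equiv]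

/-- The cell in stacking coordinates for the local type `(α, β) = (σ k, σ (k−1))`. -/
def cellCoord (α β : ℤ) : Set E3 :=
  rowSet sixOffsets 0 0 ∩ rowSet (threeOffsets (-α)) α hB ∩ rowSet (threeOffsets β) (-(β : ℝ)) (-hB)

/-- Upper half of the cell = the upper half-cell of `α` (the lower rows are inactive above the basal plane). -/
theorem cellCoord_inter_upper {α β : ℤ} (hβ : β = 1 ∨ β = -1) : cellCoord α β ∩ {p : E3 | 0 < p 2} = halfCell α := by
  ext p
  simp only [cellCoord, halfCell, Set.mem_inter_iff, Set.mem_setOf_eq]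
  constructor
  · rintro ⟨⟨⟨h6, hu⟩, -⟩, hp⟩; exact ⟨⟨hp, h6⟩, hu⟩
  · rintro ⟨⟨hp, h6⟩, hu⟩
    have hβ' : -β = 1 ∨ -β = -1 := by rcases hβ with rfl | rfl <;> simp
    refine ⟨⟨⟨h6, hu⟩, ?_⟩, hp⟩
    have h := rowOK_three_of_six hβ' (ε := -hB) (p := p) (by nlinarith [hB_pos]) h6
    simpa [neg_neg, Int.cast_neg] using h

/-- Lower half of the cell = mirror image of the upper half-cell of `−β` (the upper rows are inactive below the basal plane). -/
theorem cellCoord_inter_lower {α β : ℤ} (hα : α = 1 ∨ α = -1) :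
    cellCoord α β ∩ {p : E3 | p 2 < 0} = basalMirror ⁻¹' halfCell (-β) := by
  ext p
  simp only [cellCoord, halfCell, Set.mem_inter_iff, Set.mem_setOf_eq, Set.mem_preimage, rowOK_basalMirror, neg_neg, Int.cast_neg]
  simp only [basalMirror_apply_coord, if_true, Left.neg_pos_iff]
  simp only [neg_zero]
  constructor
  · rintro ⟨⟨⟨h6, -⟩, hd⟩, hp⟩
    exact ⟨⟨hp, h6⟩, hd⟩
  · rintro ⟨⟨hp, h6⟩, hd⟩
    exact ⟨⟨⟨h6, rowOK_three_of_six hα (by nlinarith [hB_pos]) h6⟩, hd⟩, hp⟩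

/-- **All four local types have cells of the same volume: twice the upper half-cell.** -/
theorem volume_cellCoord {α β : ℤ} (hα : α = 1 ∨ α = -1) (hβ : β = 1 ∨ β = -1) : volume (cellCoord α β) = 2 * volume (halfCell 1) := by
  rw [volume_eq_upper_add_lower, cellCoord_inter_upper hβ, cellCoord_inter_lower hα, ← basalMirror.coe_toMeasurableEquiv,
    (basalMirror.measurePreserving).measure_preimage_equiv]
  have hα1 : volume (halfCell α) = volume (halfCell 1) := by
    rcases hα with rfl | rfl
    · rfl
    · exact volume_halfCell_eq (Or.inl rfl)
  have hβ1 : volume (halfCell (-β)) = volume (halfCell 1) := by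
    rcases hβ with rfl | rfl
    · exact volume_halfCell_eq (Or.inl rfl)
    · rw [neg_neg]
  rw [hα1, hβ1, two_mul]

/-! ### The cell of a site is a translate of `cellCoord` -/

/-- The cell of the site `r = barlowPos σ k i j` is the translate by `r` of `cellCoord (σ k) (σ (k−1))`. -/
theorem cell₁₂_barlowPos_eq_preimage {σ : ℤ → ℤ} (hσ : IsHaggSeq σ) (k i j : ℤ) :
    {z : E3 | ∀ v ∈ barlowStacking 1 hB σ, dist (barlowPos 1 hB σ k i j) v = 1 → dist z (barlowPos 1 hB σ k i j) < dist z v} =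
      (fun z : E3 => z + -barlowPos 1 hB σ k i j) ⁻¹' cellCoord (σ k) (σ (k - 1)) := by
  ext z
  rw [mem_cell₁₂_barlowPos_iff hσ, Set.mem_preimage, ← sub_eq_add_neg, cellCoord, Set.mem_inter_iff, Set.mem_inter_iff, and_assoc]

/-- **(M4, coordinates) The cell of every site of a Hägg stacking has volume `√2/2`.** -/
theorem volume_cell₁₂_barlowPos {σ : ℤ → ℤ} (hσ : IsHaggSeq σ) (k i j : ℤ) :
    volume {z : E3 | ∀ v ∈ barlowStacking 1 hB σ, dist (barlowPos 1 hB σ k i j) v = 1 → dist z (barlowPos 1 hB σ k i j) < dist z v} =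
      ENNReal.ofReal (Real.sqrt 2 / 2) := by
  rw [cell₁₂_barlowPos_eq_preimage hσ, measure_preimage_add_right, volume_cellCoord (hσ k) (hσ (k - 1))]
  -- the fcc reference cell is `cellCoord 1 1` and has volume `√2/2`
  have href := volume_cell₁₂_fccRef_zero
  have h0 : (0 : E3) = barlowPos 1 hB constHagg 0 0 0 := by simp [barlowPos]
  have hset : {z : E3 | ∀ w ∈ fccRef, dist (0 : E3) w = 1 → dist z 0 < dist z w} =
      (fun z : E3 => z + -barlowPos 1 hB constHagg 0 0 0) ⁻¹' cellCoord (constHagg 0) (constHagg (0 - 1)) := by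
    rw [← cell₁₂_barlowPos_eq_preimage isHaggSeq_const, ← h0]; rfl
  rw [hset, measure_preimage_add_right, volume_cellCoord (isHaggSeq_const 0) (isHaggSeq_const (0 - 1))] at href
  exact href

/-- The cell of a moved site is the moved cell. -/
theorem cell₁₂_move_eq_image (L : E3 ≃ₗᵢ[ℝ] E3) (s : E3) (σ : ℤ → ℤ) (r : E3) :
    {z : E3 | ∀ v ∈ stacking L s σ, dist (L r + s) v = 1 → dist z (L r + s) < dist z v} =
      (fun z => L z + s) '' {z : E3 | ∀ v ∈ barlowStacking 1 hB σ, dist r v = 1 → dist z r < dist z v} := by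
  ext z
  simp only [Set.mem_setOf_eq, Set.mem_image]
  constructor
  · intro hz
    refine ⟨L.symm (z - s), fun v hv hv1 => ?_, by simp⟩
    have h := hz (L v + s) ⟨v, hv, rfl⟩ (by rw [dist_move, hv1])
    have e : z = L (L.symm (z - s)) + s := by simp
    rw [e, dist_move, dist_move] at h
    exact h
  · rintro ⟨p, hp, rfl⟩ v ⟨w, hw, rfl⟩ hv1
    rw [dist_move] at hv1 ⊢
    rw [dist_move]
    exact hp w hw hv1

/-- **(M4) Every site of every moved close-packed stacking with a Hägg word has a twelve-neighbour cell of volume `√2/2 = 1/√2`** — cuboctahedral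
(fcc-like) and anticuboctahedral (hcp-like) sites alike. -/
theorem volume_cell₁₂_of_mem_stacking {σ : ℤ → ℤ} (hσ : IsHaggSeq σ) {L : E3 ≃ₗᵢ[ℝ] E3} {s a : E3} (ha : a ∈ stacking L s σ) :
    volume {z : E3 | ∀ v ∈ stacking L s σ, dist a v = 1 → dist z a < dist z v} = ENNReal.ofReal (Real.sqrt 2 / 2) := by
  obtain ⟨r, hr, rfl⟩ : a ∈ (fun r => L r + s) '' barlowStacking 1 hB σ := ha
  obtain ⟨k, i, j, rfl⟩ := mem_barlowStacking_iff.1 hr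
  rw [cell₁₂_move_eq_image]
  set e : E3 ≃ᵐ E3 := (L.toHomeomorph.trans (Homeomorph.addRight s)).toMeasurableEquiv with he_def
  have hecoe : (fun z : E3 => L z + s) = ⇑e := rfl
  have he : MeasurePreserving (⇑e) volume volume := by
    rw [← hecoe]; exact (measurePreserving_add_right volume s).comp L.measurePreserving
  rw [hecoe, MeasurableEquiv.image_eq_preimage_symm, (he.symm e).measure_preimage_equiv, volume_cell₁₂_barlowPos hσ]

/-! ### The mass glue: finitely many locally perfect balls carry disjoint cells of total volume `#·√2/2` -/

/-- **Mass glue (TB-D-0 §3 (M5)).**  Let `X` be `1`-separated and `B` a finite set of balls, each `a ∈ B` lying on a Hägg stacking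
`stacking (L a) (s a) (σ a)` all of whose sites within `2√2` of `a` are in `X`.  Then the twelve-neighbour cells of the balls of `B` are pairwise
disjoint, each lies in `closedBall a √2`, and their union has volume `#B · √2/2` — so any set containing `⋃_{a ∈ B} closedBall a √2` has volume
`≥ #B/√2`. -/
theorem volume_biUnion_cell₁₂ {X : Set E3} (hX : X.Pairwise fun p q => 1 ≤ dist p q) (B : Finset E3) (L : E3 → (E3 ≃ₗᵢ[ℝ] E3)) (s : E3 → E3)
    (σ : E3 → ℤ → ℤ) (hσ : ∀ a ∈ B, IsHaggSeq (σ a)) (ha : ∀ a ∈ B, a ∈ stacking (L a) (s a) (σ a))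
    (hcomp : ∀ a ∈ B, ∀ b ∈ stacking (L a) (s a) (σ a), dist a b ≤ 2 * Real.sqrt 2 → b ∈ X) :
    volume (⋃ a ∈ B, {z : E3 | ∀ v ∈ stacking (L a) (s a) (σ a), dist a v = 1 → dist z a < dist z v}) =
      (B.card : ℝ≥0∞) * ENNReal.ofReal (Real.sqrt 2 / 2) := by
  rw [measure_biUnion_finset]
  · rw [Finset.sum_congr rfl fun a hab => volume_cell₁₂_of_mem_stacking (hσ a hab) (ha a hab), Finset.sum_const, nsmul_eq_mul]
  · intro a hab a' ha'b hne
    exact disjoint_cell₁₂ (hσ a hab) (hσ a' ha'b) hX hne (ha a hab) (ha a' ha'b) (hcomp a hab) (hcomp a' ha'b)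
  · intro a hab
    exact (isOpen_cell₁₂ (hσ a hab) (ha a hab)).measurableSet

/-- The union of the cells lies in the `√2`-neighbourhood of the balls (where the mesh certifies texture). -/
theorem biUnion_cell₁₂_subset (B : Finset E3) (L : E3 → (E3 ≃ₗᵢ[ℝ] E3)) (s : E3 → E3) (σ : E3 → ℤ → ℤ) (hσ : ∀ a ∈ B, IsHaggSeq (σ a))
    (ha : ∀ a ∈ B, a ∈ stacking (L a) (s a) (σ a)) :
    (⋃ a ∈ B, {z : E3 | ∀ v ∈ stacking (L a) (s a) (σ a), dist a v = 1 → dist z a < dist z v}) ⊆ ⋃ a ∈ B, Metric.closedBall a (Real.sqrt 2) :=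
  Set.iUnion₂_mono fun a hab => cell₁₂_subset_closedBall (hσ a hab) (ha a hab)

/-- **Mass inequality.**  Under the hypotheses of `volume_biUnion_cell₁₂`, every set `T` containing the `√2`-balls about the balls of `B` has
`#B · √2/2 ≤ volume T`, i.e. `#B ≤ √2 · volume T`. -/
theorem card_mul_le_volume_of_closedBalls_subset {X : Set E3} (hX : X.Pairwise fun p q => 1 ≤ dist p q) (B : Finset E3)
    (L : E3 → (E3 ≃ₗᵢ[ℝ] E3)) (s : E3 → E3) (σ : E3 → ℤ → ℤ) (hσ : ∀ a ∈ B, IsHaggSeq (σ a)) (ha : ∀ a ∈ B, a ∈ stacking (L a) (s a) (σ a))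
    (hcomp : ∀ a ∈ B, ∀ b ∈ stacking (L a) (s a) (σ a), dist a b ≤ 2 * Real.sqrt 2 → b ∈ X) {T : Set E3}
    (hT : (⋃ a ∈ B, Metric.closedBall a (Real.sqrt 2)) ⊆ T) :
    (B.card : ℝ≥0∞) * ENNReal.ofReal (Real.sqrt 2 / 2) ≤ volume T := by
  rw [← volume_biUnion_cell₁₂ hX B L s σ hσ ha hcomp]
  exact measure_mono ((biUnion_cell₁₂_subset B L s σ hσ ha).trans hT)

end Summit.Ventures.Crystal3D.Cruxes.TextureLiminf.TexShadow

end
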